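import Summits.AtomisticToContinuum.Crystallization.Theorems.FrustratedLawDichotomyStrainedPatchHomEntryLeafHTA2QCellG75SV2

/-!
# v3 ANCHOR CELL (T0) `cG75S × wG75S` (0.75 t_b, SEVEN-coarse: 2⁻¹⁰ on (0,0),(1,1), 2⁻⁹ else (k₆ = 4)), part 3: far sum, ONE inner leaf, END TO END in the v3 currency
# (27623 `(H) HomFloor (1/625)`, hcp half; pre-staged by hand-1 g37, LANDED by hand-1 g38 on critic GO row 1436 (E) / 1437 (E) «T0 anchors»)

Kernel facts + assembly; 0 sorry; standard axioms.  `--supports stmt-AtomisticToContinuum-27623`.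
-/

namespace Summit.AtomisticToContinuum.Crystallization.Theorems.FrustratedLawDichotomyStrainedPatchHomEntryLeafHT

open Literature.Analysis.ValidatedNumerics.Numerics
open Summit.AtomisticToContinuum.Crystallization.Theorems.FrustratedLawDichotomyStrainedPatchHomCertTree (CertTree treeOK)
open Summit.AtomisticToContinuum.Crystallization.Theorems.FrustratedLawDichotomyStrainedPatchHomEntryTable (muRec)
open Summit.AtomisticToContinuum.Crystallization.Theorems.FrustratedLawDichotomyStrainedPatchHomEntryFitHcpCentred (entryLeafOKHQDCRS)
open Summit.AtomisticToContinuum.Crystallization.Theorems.FrustratedLawDichotomyStrainedPatchHomSlopeLJ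
open Summit.AtomisticToContinuum.Crystallization.Theorems.FrustratedLawDichotomyStrainedPatchHomSlopeLJAffine
open Summit.AtomisticToContinuum.Crystallization.Theorems.FrustratedLawDichotomyStrainedPatchHomSlopeLJAffine2Kit
open Summit.AtomisticToContinuum.Crystallization.Theorems.FrustratedLawDichotomyStrainedPatchHomSlopeLJAffine2KitS (rem3LJS)

set_option maxRecDepth 100000 in
set_option maxHeartbeats 4000000 in
/-- ★ KERNEL: `GnG75SV + far₁ + far₂ ≤ pG75SV.Gs`. -/
theorem farG75SV : GnG75SV + htGsNA cG75S wG75S JG75S (htFar1U cG75S wG75S) + htGsNA cG75S wG75S JG75S (htFar2U cG75S wG75S) ≤ pG75SV.Gs := by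
  decide +kernel

/-- ★★★ The sharp-remainder certificate side of the cell holds. [assembly] -/
theorem htCertSideA2QS_G75SV : htCertSideA2QS pG75SV QG75S GnG75SV JG75S cG75S wG75S = true :=
  htCertSideA2QS_of_parts restG75SV qG75S_0 qG75S_1 qG75S_2 linG75SV farG75SV

set_option maxRecDepth 100000 in
set_option maxHeartbeats 4000000 in
/-- ★ KERNEL: ONE inner hull leaf of the squared-test inner verdict closes the confined box `htWr pG75SV`. -/
theorem treeA2QS_G75SV : treeOK (hullInner (entryLeafOKHQDCRS muRec qX90c) JG75S cG75S) CertTree.leaf cG75S (htWr pG75SV cG75S wG75S) = true := by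
  decide +kernel

/-- ★★★ **THE CELL CLOSES END TO END IN THE v3 CURRENCY** (one inner leaf). [assembly] -/
theorem entryLeafOKHT4A2QSQDCRS_G75SV : entryLeafOKHT4A2QSQDCRS muRec qX90c pG75SV QG75S GnG75SV JG75S CertTree.leaf cG75S wG75S = true :=
  entryLeafOKHT4A2QSQDCRS_of_parts htCertSideA2QS_G75SV treeA2QS_G75SV

/-- ★ … hence the cell is a one-leaf ∃-tree of the production verdict v3 `entryLeafOKHT4A2QQDCRS3 muRec`. [formal bookkeeping] -/
theorem okS3_G75S : ∃ t : CertTree ((Fin 3 × Fin 3) ⊕ Fin 3), treeOK (entryLeafOKHT4A2QQDCRS3 muRec) t cG75S wG75S = true :=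
  exists_tree_HT4A2QQDCRS3_of_certS3 entryLeafOKHT4A2QSQDCRS_G75SV

end Summit.AtomisticToContinuum.Crystallization.Theorems.FrustratedLawDichotomyStrainedPatchHomEntryLeafHT
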